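import Summits.QuantumFields.YangMills.Theorems.UnitScaleTiltProp7MassiveDivergenceSupKnit
import Summits.QuantumFields.YangMills.Theorems.UnitScaleTiltProp7CurvedMemberLocalHolder
import HarnessLib

/-!
# Route `UnitScaleTilt`, crux K1 «MinimiserStabilityRegPr» (stmt-QuantumFields-19200), EX row (5) `h3` (STOREY H), H2 pipeline (ii) — programme **H2-LOC**: **THE LETTER `hWsup` CLOSED
# IN TREE** — px5 g16's KNIT ✓`Prop7MassiveDivergenceSupKnit.hWsup_of_hHlocV_agmon` (`hHlocV ⟹ hWsup`, over its DOOR ✓p782042 and cst-p1 g38's Agmon row ✓p781977) composed with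
# ✓p782216 `Prop7CurvedMemberLocalHolder.exists_hHlocV` (`hHlocV` discharged): `∃ Cw θw, 0 ≤ Cw ∧ 0 < θw ∧ ⟨hWsup a03f6c184c689677 VERBATIM⟩` — the sup of the massive covariant
# resolvent on divergence data at every printed-regular background, K-free (★★OWNER RULING №52's second letter; RECORD 17dq).

Cell `ym3-torus` (HUMAN RULING D-0037; rung R3 = SU(2) YM₃ on T³ — NOT d = 4, NOT infinite volume, NOT a mass gap, NOT Clay).  Width seat `ym3-torus-px19` (gen 16);
`--supports stmt-QuantumFields-19200 --as helper`; count-neutral; THEOREMS ONLY (0 `def`, 0 `sorry`, default heartbeats).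

WHAT IS PROVED (ns `Summit.QuantumFields.YangMills.Theorems.Prop7MassiveDivergenceSupClosed`): ★★★ `exists_hWsup` — the frozen text `hWsup` (HOME `ym3-torus-px19/g16/H2LOC-LETTER-hWsup.px19g16.txt`,
sha16 a03f6c184c689677) after `∃ Cw θw : ℝ, 0 ≤ Cw ∧ 0 < θw ∧`, with NO hypothesis.  HYP-SAT (★★OWNER RULING №42): none displayed.  HONEST SCOPE: a two-line composition of landed
theorems (px5 g16's KNIT∕DOOR, cst-p1 g38's A-ROW, this seat's H2-LOC C1–C5b); `hUsup`, `hPen`, `h3`, norm_G, EX, 19200 and the rung are NOT proved; the Yang–Mills mass gap is NOT proved.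

References: T. Bałaban, CMP **99** (1985) 389–434 [Balaban1985BackgroundPropagators] (Thm 3.1 (3.42)–(3.43) pp.397–398); CMP **96** (1984) 223–250 [Balaban1984PropagatorsII] ((1.9) p.226).
-/

set_option autoImplicit false

noncomputable section

open scoped InnerProductSpace ComplexConjugate BigOperators Matrix.Norms.L2Operator

namespace Summit.QuantumFields.YangMills.Theorems.Prop7MassiveDivergenceSupClosed

open Literature.MathematicalPhysics.QuantumFieldTheory.Balaban1983to89
open Literature.MathematicalPhysics.QuantumFieldTheory.Balaban1983to89.T3ContinuumYM3Torus
open B4Sect5Torus (TSite tdist)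
open B9SectCLatticeCarrier (Bond)
open B9Eq311L2Pairing (WL2)
open B11Eq103H1Complex (SiteL2K BondL2K)
open T3PrintedRegularMinimiser (RegPr)
open Summit.QuantumFields.YangMills.Theorems.Prop7SectET3Transport (periodsT3 bgOfCfg)
open Summit.QuantumFields.YangMills.Theorems.Prop7SectET3HilbertLetters (W₂ DstarL2 covLapSite)
open Summit.QuantumFields.YangMills.Theorems.Prop7MassiveDivergenceSupKnit (hWsup_of_hHlocV_agmon)
open Summit.QuantumFields.YangMills.Theorems.Prop7CurvedMemberLocalHolder (exists_hHlocV)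

/-- ★★★ **`hWsup` CLOSED IN TREE**: the sup of `w = (Δ^η_{U₀} + 1)⁻¹D*_{U₀}x` at every printed-regular background is bounded by `Cw·sup‖x‖`, K-free — px5 g16's KNIT (`hHlocV ⟹ hWsup`)
composed with `exists_hHlocV`. [cite: Balaban1985BackgroundPropagators, Thm 3.1 (3.42)–(3.43) pp.397–398; Balaban1984PropagatorsII, (1.9) p.226] -/
theorem exists_hWsup : ∃ Cw θw : ℝ, 0 ≤ Cw ∧ 0 < θw ∧
    (∀ (F : T3Family) (n K : ℕ) (c₀ : ℝ) [Fact (0 < c₀)] (ε₀ : ℝ) (U₀ : GaugeField (F.P K) 0 (Matrix.specialUnitaryGroup (Fin 2) ℂ)),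
      0 ≤ ε₀ → ε₀ ≤ θw → RegPr F n K ε₀ U₀ →
      ∀ (w : SiteL2K ℂ 3 (periodsT3 F K) c₀ W₂) (x : BondL2K ℂ 3 (periodsT3 F K) c₀ W₂) (X : ℝ), 0 ≤ X →
      covLapSite F n K c₀ U₀ w + ((1 : ℝ) : ℂ) • w = DstarL2 F n K c₀ U₀ x →
      (∀ b : Bond 3 (periodsT3 F K), ‖WL2.equiv ℂ (fun _ : Bond 3 (periodsT3 F K) => c₀) W₂ x b‖ ≤ X) →
      ∀ y : TSite 3 (periodsT3 F K), ‖WL2.equiv ℂ (fun _ : TSite 3 (periodsT3 F K) => c₀) W₂ w y‖ ≤ Cw * X) := by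
  obtain ⟨Ch, θ₀, hCh, hθ₀, hH⟩ := exists_hHlocV
  exact hWsup_of_hHlocV_agmon Ch θ₀ hCh hθ₀ hH

end Summit.QuantumFields.YangMills.Theorems.Prop7MassiveDivergenceSupClosed

end
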